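import Literature.Algebra.Polynomial.JacobianCriterion
import Mathlib.Algebra.MvPolynomial.PDeriv
import Mathlib.RingTheory.MvPolynomial.Basic
import HarnessLib

/-!
# Partial derivatives under the `w`-chart of a point blow-up — the transformation law of the Jacobian ideal
# (pure commutative algebra; Theses-free, def-free)

OURS (campaign `res-hironaka`, rung L ★L-G4, slot W4.1, crux `Steer` stmt-ResolutionOfSingularities-16345; seat res-D-pv-011; support for
res-L0-w41-strat-2 MEMO rev 12 §6⁗ (B2)/(C) and res-L0-w41-plan-1 RULING 66 (the «K1 transformation law»); replaces the role of no printed item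
and is NOT a statement of the manuscript under review [claim: Hironaka2017, status: under-review]; AI-produced, weaker than expert review).

Setting: `R` any commutative ring, `ι` a finite index type, `j : ι` the exceptional variable. The `X j`-chart of the blow-up of the origin is
the substitution `c : X i ↦ X j * X i (i ≠ j)`, `X j ↦ X j`, i.e. `aeval c`. For every polynomial `F`:

* `pderiv_chart_of_ne` — `∂_i (F ∘ c) = X j · (∂_i F) ∘ c` for `i ≠ j` (chain rule);
* `X_mul_pderiv_chart_self` — `X j · ∂_j (F ∘ c) = (Σ_k X k · ∂_k F) ∘ c` (the Euler combination);
* strict-transform forms: if `F ∘ c = X j ^ d · f′` then `X j ^ (d - 1) · ∂_i f′ = (∂_i F) ∘ c` (`i ≠ j`, `1 ≤ d`) and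
  `d · X j ^ d · f′ + X j ^ (d + 1) · ∂_j f′ = (Σ_k X k ∂_k F) ∘ c`, so `X j ^ (d + 1) · ∂_j f′ = (Σ_k X k ∂_k F) ∘ c` whenever `(d : R) = 0`
  (e.g. `char R = 2` and `d` even — the situation of §6⁗ (B1)).

Consequence recorded in prose only (no ideal-level statement is needed by the consumers): the Jacobian ideal of the strict transform is the
controlled transform (exponent `d − 1`) of the old one plus ONE Euler generator divided by two more powers of `X j`. Chain rule = tree
`Literature.Algebra.Polynomial.JacobianCriterion.pderiv_aeval`. [folklore]
-/

noncomputable section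

set_option linter.dupNamespace false

open MvPolynomial

namespace Summit.ResolutionOfSingularities.ResolutionOfSingularities.Theorems.SwitchingDichotomy.BlowupChartDerivatives

open Literature.Algebra.Polynomial.JacobianCriterion

universe u v

variable {R : Type u} [CommRing R] {ι : Type v} [DecidableEq ι]

/-- Derivative of the chart substitution: `∂_i (c k)` for `i ≠ j` is `X j` if `k = i` and `0` otherwise. [folklore] -/
theorem pderiv_chart_apply_of_ne (j : ι) {i : ι} (hij : i ≠ j) (k : ι) :
    pderiv i ((fun k : ι => if k = j then (X j : MvPolynomial ι R) else X j * X k) k) =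
      if k = i then X j else 0 := by
  by_cases hkj : k = j
  · subst hkj
    simp only [if_true, if_neg (Ne.symm hij)]
    exact pderiv_X_of_ne (Ne.symm hij)
  · simp only [if_neg hkj]
    rw [pderiv_mul, pderiv_X_of_ne (Ne.symm hij), zero_mul, zero_add]
    by_cases hki : k = i
    · subst hki; rw [if_pos rfl, pderiv_X_self, mul_one]
    · rw [if_neg hki, pderiv_X_of_ne hki, mul_zero]

/-- Derivative of the chart substitution in the exceptional direction: `∂_j (c j) = 1`, `∂_j (c k) = X k` for `k ≠ j`. [folklore] -/
theorem pderiv_chart_apply_self (j k : ι) :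
    pderiv j ((fun k : ι => if k = j then (X j : MvPolynomial ι R) else X j * X k) k) =
      if k = j then 1 else X k := by
  by_cases hkj : k = j
  · subst hkj
    simp only [if_true]
    exact pderiv_X_self k
  · simp only [if_neg hkj]
    rw [pderiv_mul, pderiv_X_self, one_mul, pderiv_X_of_ne hkj, mul_zero, add_zero]

variable [Fintype ι]

/-- **Chain rule in the `X j`-chart, non-exceptional direction**: for `i ≠ j`,
`∂_i (F ∘ c) = X j · (∂_i F) ∘ c`. [folklore] -/
theorem pderiv_chart_of_ne (j : ι) (F : MvPolynomial ι R) {i : ι} (hij : i ≠ j) :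
    pderiv i (aeval (fun k : ι => if k = j then (X j : MvPolynomial ι R) else X j * X k) F) =
      X j * aeval (fun k : ι => if k = j then (X j : MvPolynomial ι R) else X j * X k) (pderiv i F) := by
  rw [pderiv_aeval]
  simp_rw [pderiv_chart_apply_of_ne j hij, mul_ite, mul_zero]
  rw [Finset.sum_ite_eq' Finset.univ i, if_pos (Finset.mem_univ i), mul_comm]

/-- **Chain rule in the `X j`-chart, exceptional direction (Euler combination)**:
`X j · ∂_j (F ∘ c) = (Σ_k X k · ∂_k F) ∘ c`. [folklore] -/
theorem X_mul_pderiv_chart_self (j : ι) (F : MvPolynomial ι R) :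
    X j * pderiv j (aeval (fun k : ι => if k = j then (X j : MvPolynomial ι R) else X j * X k) F) =
      aeval (fun k : ι => if k = j then (X j : MvPolynomial ι R) else X j * X k) (∑ k, X k * pderiv k F) := by
  rw [pderiv_aeval, Finset.mul_sum, map_sum]
  refine Finset.sum_congr rfl fun k _ => ?_
  rw [map_mul, aeval_X, pderiv_chart_apply_self]
  by_cases hkj : k = j
  · subst hkj
    simp only [if_true]; ring
  · simp only [if_neg hkj]; ring

/-- **Strict transform, non-exceptional direction**: if `F ∘ c = X j ^ d · f′` with `1 ≤ d` then
`X j ^ (d - 1) · ∂_i f′ = (∂_i F) ∘ c` for `i ≠ j` (one power of `X j` cancelled; `X j` is a non-zero-divisor). [folklore] -/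
theorem X_pow_mul_pderiv_strict_of_ne (j : ι) (F f' : MvPolynomial ι R) {d : ℕ} (hd : 1 ≤ d)
    (hF : aeval (fun k : ι => if k = j then (X j : MvPolynomial ι R) else X j * X k) F = X j ^ d * f') {i : ι}
    (hij : i ≠ j) :
    X j ^ (d - 1) * pderiv i f' =
      aeval (fun k : ι => if k = j then (X j : MvPolynomial ι R) else X j * X k) (pderiv i F) := by
  have h := pderiv_chart_of_ne j F hij
  rw [hF, pderiv_mul, pderiv_pow, pderiv_X_of_ne (Ne.symm hij), mul_zero, zero_mul, zero_add] at h
  -- `h : X j ^ d * pderiv i f' = X j * aeval c (pderiv i F)`; cancel one `X j`.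
  obtain ⟨e, rfl⟩ : ∃ e, d = e + 1 := ⟨d - 1, (Nat.sub_add_cancel hd).symm⟩
  rw [pow_succ', mul_assoc] at h
  rw [Nat.add_sub_cancel]
  exact (isRegular_X (R := R) (n := j)).left h

/-- **Strict transform, exceptional direction**: if `F ∘ c = X j ^ d · f′` then
`d · X j ^ d · f′ + X j ^ (d + 1) · ∂_j f′ = (Σ_k X k · ∂_k F) ∘ c`. [folklore] -/
theorem euler_strict (j : ι) (F f' : MvPolynomial ι R) {d : ℕ}
    (hF : aeval (fun k : ι => if k = j then (X j : MvPolynomial ι R) else X j * X k) F = X j ^ d * f') :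
    (d : MvPolynomial ι R) * X j ^ d * f' + X j ^ (d + 1) * pderiv j f' =
      aeval (fun k : ι => if k = j then (X j : MvPolynomial ι R) else X j * X k) (∑ k, X k * pderiv k F) := by
  have h := X_mul_pderiv_chart_self j F
  rw [hF, pderiv_mul, pderiv_pow, pderiv_X_self, mul_one] at h
  rw [← h]
  rcases Nat.eq_zero_or_pos d with rfl | hd
  · simp
  · obtain ⟨e, rfl⟩ : ∃ e, d = e + 1 := ⟨d - 1, (Nat.sub_add_cancel hd).symm⟩
    simp only [Nat.add_sub_cancel, Nat.cast_add, Nat.cast_one]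
    ring

/-- **Strict transform, exceptional direction, `d = 0` in `R`** (e.g. characteristic `2` and `d` even): if `F ∘ c = X j ^ d · f′` and
`(d : R) = 0` then `X j ^ (d + 1) · ∂_j f′ = (Σ_k X k · ∂_k F) ∘ c` — the ONE new Euler generator of the transformed Jacobian ideal,
divided by two more powers of `X j` than the others. [folklore] -/
theorem X_pow_mul_pderiv_strict_self_of_cast_eq_zero (j : ι) (F f' : MvPolynomial ι R) {d : ℕ}
    (hd : (d : R) = 0)
    (hF : aeval (fun k : ι => if k = j then (X j : MvPolynomial ι R) else X j * X k) F = X j ^ d * f') :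
    X j ^ (d + 1) * pderiv j f' =
      aeval (fun k : ι => if k = j then (X j : MvPolynomial ι R) else X j * X k) (∑ k, X k * pderiv k F) := by
  have h := euler_strict j F f' hF
  have hd' : (d : MvPolynomial ι R) = 0 := by
    rw [← map_natCast (C : R →+* MvPolynomial ι R), hd, map_zero]
  rwa [hd', zero_mul, zero_mul, zero_add] at h

end Summit.ResolutionOfSingularities.ResolutionOfSingularities.Theorems.SwitchingDichotomy.BlowupChartDerivatives

end
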